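import Literature.MathematicalPhysics.QuantumFieldTheory.Balaban1983to89.B8CubeMemberBoxDomainsL0
import Literature.MathematicalPhysics.QuantumFieldTheory.Balaban1983to89.B6MultiLevelTorusOperatorL0
import Literature.MathematicalPhysics.QuantumFieldTheory.Balaban1983to89.B6TorusDepthDistance
import Literature.MathematicalPhysics.QuantumFieldTheory.Balaban1983to89.B6GlobalChartV1

/-!
# `Balaban1983to89.B8CubeMemberTorusDomainsL0` — [Balaban1985RegularSpaces] p. 98–99: THE CUBE MEMBER `(T, □₁, …, □_n)` OF (1.131), LEVEL `0` INCLUDED,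
# AS A MEMBER OF THE [B6] §2 TORUS FAMILY WITH `Λ₀` (`B6MultiLevelTorusOperatorL0.TDomains`) — TRANSPLANT STEP T2a of the N05 flat road

statement-level skeleton of published theorems with citation tags; proofs where landed; nothing here is a claim about the
Yang–Mills mass gap

`[Balaban1985RegularSpaces]` ("B8", CMP **99** (1985) 75–102) p. 98 («Let us take a sequence of cubes □₀, □₁, …, □_{k−1}, □_k, □, such that □_j ⊃ □_{j+1} and
a distance between boundaries of these cubes is equal to R₁M₁Lʲη … for every j the cube □_j is a sum of the big blocks of the lattice T_{L^{−j}}»), (1.131) p. 99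
(«Λ′₀ = T ∖ □₁»); `[Balaban1984PropagatorsII]` ("B6", CMP **96** (1984) 223–250) (2.1)–(2.4) p. 224 («Ω_j ⊂ T_η … (Lʲη)⁻¹dist(Ω_jᶜ, Ω_{j+1}) > RM … we admit the
case when some domains Ω_j are equal to T_η», «Λ₀ = Ω₁ᶜ … B⁰(Λ₀) = Λ₀»), (2.14) p. 225 («(Q′₀λ)(x) = λ(x), x ∈ Λ₀»).  PDF held:
`paper:balaban1985-cmp99-regular-spaces-gauge-fixing` (journal page = PDF page + 74).

CITATION HEADER (lean-in-tree rule).  Cell `pub-ymgap` (YM Track A, HUMAN RULING D-0062), DAG node N05 = [B8], seat `pub-ymgap-dag-n05-c` (g12).  WHY THIS FILE (the seat's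
`TRANSPLANT-DESIGN.md`, step T2): the one open per-cube estimate of N05's flat `U₀ = 1` road is `B8Ineq159FlatCubeMemberPrinted.Ineq159FlatCubeMemberPrinted` ([4] Thm 3.3 at
`U = 1` on the Dirichlet cube member); its discharge road is the zero-extension of the member's field to a big torus `T ⊃ t + □₀` carrying the family `(T, t+□₁, …, t+□_n)`
— the shell `t + (□₀ ∖ □₁)` and the rest of `T` at LEVEL `0` — followed by the `k`-level torus reading of (1.59) WITH LEVEL-0 SITES (lit-balaban sub-row G-F3′-L0∕B8, ME #33,
the commissioned `…L0` twin of `B8Prop3MultiLevelTorusP26`).  That reading is stated on `D : B6MultiLevelTorusOperatorL0.TDomains d ℓ M_h k P′ R` under the chart hypothesis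
`hN : N0 ℓ M_h k P′ ≡ 2L^{m+K}` of `B6GlobalChartV1`; THIS FILE builds that `D` for the cube member (G1 `B8CubeMemberBoxDomainsL0.cubeDomainsL0` was the BOX version) and a
host presentation `P′ = 2Lᵉ` satisfying `hN`.

WHAT THIS FILE PROVES (kernel-checked; `L = ℓ + 1 ≥ 2`; cube datum `(a, M, ρ, k)` of `B8Eq131Cubes`, truncation `1 ≤ n ≤ k`; side conditions as F1∕G1: `M_h·L ∣ ρ`, `M_h·L ∣ M`,
`R·(M_h·L) ≤ ρ`, `M_h ≥ 2`; host multipliers `P ≥ boxP` componentwise).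
* §1 `torP ℓ e := (2Lᵉ)_μ`; `N0_torP_eq` (`N0 ℓ (Lˢ) n (torP ℓ e) = 2L^{n+1+s+e}`), ★ `N0_torP_eq_sitesPerDir` (= the period `2L^{m_V+K_V}` of the V1 torus `PV d ℓ m_V K_V` whenever
  `n + 1 + s + e = m_V + K_V` — the `hN` of the torus readings), `exists_torP_ge` (every bound fits under some `2Lᵉ`, `e ≥ 2`).
* §2 `N0_mono`, `boxDom_N0_mono` (bigger multipliers, bigger box), ★ `siteDeep_shift_of_mem_cube_zero` — G1's embedding `t + □₀ ⊂ X` with the margins made explicit: every site of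
  `t + □₀` is `ρLⁿ`-DEEP in `Π_μ[0, N0 ℓ M_h n P_μ)` for every `P ≥ boxP` (`B6TorusDepthDistance.SiteDeep`); `mem_boxDom_shift_of_mem_cube_zero'`.
* §3 ★★ `cubeTDomainsL0 … (P) (hfit : boxP ≤ P) : B6MultiLevelTorusOperatorL0.TDomains d ℓ M_h n P R` — THE MEMBER ON THE TORUS: `lev := levL0` (G1), (2.1) `bigBlocks` for every `j ≥ 1`
  (F1 `mem_cube_iff_of_blk_eq`), (2.2) `sepT` IN THE TORUS METRIC: a site off `t + □_j` and a site of `t + □_{j+1}` differ by `> ρLʲ ≥ R·M_hL^{j+1}` in some coordinate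
  (F1 `collar_gap`, `R_bigSide_le`), and no wrap-around is shorter because the second site is `ρLⁿ`-deep (`B6TorusDepthDistance.min_le_circAbs_sub`,
  `B6Geom246MultiLevelTorus.torusSupNorm_neg`); `cubeTDomainsL0_lev` (`rfl`), ★ `le_lev_cubeTDomainsL0_iff` (`j ≤ lev y ⇔ y − t ∈ □_j`, `1 ≤ j ≤ n`), `lev_cubeTDomainsL0_pos_iff`,
  `cubeTDomainsL0_toDomains_lev`.
* §4 the identity chart of `B6GlobalChartV1` at the member: `lev_cubeTDomainsL0_toBox` (the torus level of a V1 site is `levL0` of its label vector), `toBox_mem_shift_cube_iff`.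

HONEST SCOPE ∕ NOT CLAIMED.  Geometry and bookkeeping: the `D` (and `hN`) at which the commissioned level-0 twin of the torus (1.59) reading will be instantiated; no estimate,
no operator identification (`dcE∕dcsE∕dsE∕QE∕laplace` on the V1 torus vs `covDerivFwd∕Jcur∕covDivB∕linCovIter∕covLap` on `ℤᵈ` under the chart is the next file, T2b).  The torus is
cubic with period `2L^{n+1+s+e}` (`M_h = Lˢ`), an honest restriction inherited from `B6GlobalChartV1` (HONEST SCOPE (1) there).  Count-neutral; N05 NOT discharged; one finite
`T⁴` programme at fixed `ε`, Bałaban as printed; nothing continuum ∕ ℝ⁴ ∕ OS ∕ mass-gap ∕ Clay.  No `sorry`, no `instance`, no `notation`; one `def` (`torP`) and one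
structure-valued `def` (`cubeTDomainsL0`).  Unit `pub-ymgap-dag-n05-c` (g12), 2026-08-27.

RELATED IN THE TREE, NOT DUPLICATED (`rg` 2026-08-27T23:12Z): G1 `B8CubeMemberBoxDomainsL0.cubeDomainsL0` (the BOX member, USED for `lev`∕`bigBlocks` plumbing),
F1 `B8CubeMemberBoxDomains.*` (USED), `B6MultiLevelTorusOperatorL0.TDomains` (r03; the structure), `B6MemberTorusTDomainsV1L0.twoLevelT` (p22∕r03; the TWO-level member torus of
[B6] (2.89) — a different family), `B6TorusDepthDistance.*` (r03; USED), `B6GlobalChartV1.toBox`∕`PV` (r03; USED).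
-/
noncomputable section

namespace Literature.MathematicalPhysics.QuantumFieldTheory.Balaban1983to89.B8CubeMemberTorusDomainsL0

open B6MultiLevelBoxOperator (N0 bigSide)
open B4Reflection242 (boxDom mem_boxDom blk)
open B4ContourShift (supNorm abs_le_supNorm)
open B4TorusKernel.MultiPeriod (circAbs torusSupNorm)
open B7Prop1Local (InBox)
open B8Eq131Cubes (gs cube bLo bHi cube_anti)
open B8Eq191FlatDirichletDepth (fm loC hiC mem_cube_iff_inBox fm_succ)
open B8CubeMemberBoxDomains (shift boxP mem_cube_iff_of_blk_eq collar_gap fm_one_le_top fm_le_fm_one N0_boxP_eq R_bigSide_le add_shift_sub_shift)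
open B8CubeMemberBoxDomainsL0 (levL0 levL0_le le_levL0_iff levL0_pos_iff fm_zero_le cube_subset_cube_one cube_one_subset_cube_zero)
open B6TorusDepthDistance (SiteDeep min_le_circAbs_sub)
open B6Geom246MultiLevelTorus (torusSupNorm_neg)
open B6GlobalChartV1 (PV toBox toBox_apply)

variable {d : ℕ}

/-! ## §1 A host presentation matching the V1 torus period: `P_μ = 2Lᵉ` -/

/-- The host multipliers `P_μ = 2Lᵉ` (all directions equal): with `M_h = Lˢ` the box side `N0 ℓ M_h n P = Lⁿ·L·M_h·P` is `2L^{n+1+s+e}`, the period of a V1 torus.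
[cite: Balaban1984PropagatorsII, (2.1) p.224 («Ω_j ⊂ T_η»); Balaban1983RegularityDecay, p.572 (T_η with periodic conditions), dictionary] -/
def torP (ℓ e : ℕ) : Fin (d + 1) → ℕ := fun _ => 2 * (ℓ + 1) ^ e

/-- `torP ℓ e μ = 2Lᵉ`. [folklore] [cite: Balaban1984PropagatorsII, (2.1) p.224, dictionary] -/
@[simp] theorem torP_apply (ℓ e : ℕ) (μ : Fin (d + 1)) : torP (d := d) ℓ e μ = 2 * (ℓ + 1) ^ e := rfl

/-- `N0 ℓ (Lˢ) n (torP ℓ e) μ = 2·L^{n+1+s+e}`. [folklore] [cite: Balaban1984PropagatorsII, (2.1) p.224, dictionary] -/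
theorem N0_torP_eq (ℓ s n e : ℕ) (μ : Fin (d + 1)) : N0 ℓ ((ℓ + 1) ^ s) n (torP (d := d) ℓ e) μ = 2 * (ℓ + 1) ^ (n + 1 + s + e) := by
  simp only [N0, torP_apply, pow_add, pow_one]
  ring

/-- ★ **THE CHART HYPOTHESIS `hN` OF THE V1 TORUS READINGS HOLDS FOR THE HOST `P = 2Lᵉ`, `M_h = Lˢ`**: `N0 ℓ (Lˢ) n (torP ℓ e) ≡ (PV d ℓ m_V K_V).sitesPerDir 0 = 2L^{m_V+K_V}`
whenever `n + 1 + s + e = m_V + K_V` («the fundamental box IS the torus», `B6GlobalChartV1.toBox`). [cite: Balaban1984PropagatorsII, (2.1) p.224; Balaban1983RegularityDecay, p.572, dictionary] -/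
theorem N0_torP_eq_sitesPerDir (ℓ s n e mV KV : ℕ) (hd : 1 ≤ d + 1) (hL : Odd (ℓ + 1) ∧ 1 < ℓ + 1) (he : n + 1 + s + e = mV + KV) :
    ∀ μ : Fin (d + 1), N0 ℓ ((ℓ + 1) ^ s) n (torP (d := d) ℓ e) μ = (PV d ℓ mV KV hd hL).sitesPerDir 0 := by
  intro μ
  rw [N0_torP_eq, Params.sitesPerDir, Nat.sub_zero, ← he]

/-- **Every bound fits under some `2Lᵉ` with `e ≥ 2`** (`L ≥ 2`): the host can always be taken large enough for the cube member AND for the torus readings' `P′ ≥ 5L`.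
[folklore] [cite: Balaban1984PropagatorsII, (2.1) p.224 («Ω_j ⊂ T_η»), dictionary] -/
theorem exists_torP_ge {ℓ : ℕ} (hℓ : 1 ≤ ℓ) (B : ℕ) : ∃ e : ℕ, 2 ≤ e ∧ B ≤ 2 * (ℓ + 1) ^ e := by
  refine ⟨B + 2, by omega, ?_⟩
  have h1 : B < (ℓ + 1) ^ B := Nat.lt_pow_self (by omega)
  have h2 : (ℓ + 1) ^ B ≤ (ℓ + 1) ^ (B + 2) := Nat.pow_le_pow_right (Nat.succ_pos ℓ) (by omega)
  omega

/-! ## §2 The translated `□₀` is `ρLⁿ`-deep in every host box `Π_μ[0, N0 ℓ M_h n P_μ)` with `P ≥ boxP` -/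

/-- `N0` is monotone in the multipliers. [folklore] [cite: Balaban1984PropagatorsII, (2.1) p.224, dictionary] -/
theorem N0_mono {ℓ Mh n : ℕ} {P P' : Fin (d + 1) → ℕ} (h : ∀ μ, P μ ≤ P' μ) (μ : Fin (d + 1)) : N0 ℓ Mh n P μ ≤ N0 ℓ Mh n P' μ := by
  simp only [N0]
  exact Nat.mul_le_mul_left _ (Nat.mul_le_mul_left _ (Nat.mul_le_mul_left _ (h μ)))

/-- Bigger multipliers, bigger box. [folklore] [cite: Balaban1984PropagatorsII, (2.1) p.224, dictionary] -/
theorem boxDom_N0_mono {ℓ Mh n : ℕ} {P P' : Fin (d + 1) → ℕ} (h : ∀ μ, P μ ≤ P' μ) : boxDom (N0 ℓ Mh n P) ⊆ boxDom (N0 ℓ Mh n P') := by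
  intro x hx
  rw [mem_boxDom] at hx ⊢
  intro i
  obtain ⟨h0, h1⟩ := hx i
  exact ⟨h0, lt_of_lt_of_le h1 (by exact_mod_cast N0_mono h i)⟩

/-- ★ **THE TRANSLATED `□₀` IS `ρLⁿ`-DEEP IN THE HOST BOX**: for `x ∈ □₀` and every `P ≥ boxP`, `ρLⁿ ≤ (x + t)_μ` and `(x + t)_μ + ρLⁿ ≤ N0 ℓ M_h n P_μ` (`L ≥ 2`, `M_h ≥ 2`,
`1 ≤ n ≤ k`) — the lower margin is `M_hL^{n+1}ρ − (m₀ − m_n) ≥ M_hL^{n+1}ρ − ρLⁿ`, the upper one `M_hL^{k+1}(M + 2ρ) − LᵏM − m₀ − m_n ≥ ρL^{k+1}` (p. 98: «Σ_{j=0}^{k} R₁M₁Lʲη ≤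
2R₁M₁Lᵏη»).  G1's `mem_boxDom_of_mem_cube_zero` with the margins kept. [cite: Balaban1985RegularSpaces, p.98 (display before (1.128)); Balaban1984PropagatorsII, (2.1) p.224 («Ω_j ⊂ T_η»), (2.36) p.229] -/
theorem siteDeep_shift_of_mem_cube_zero {ℓ Mh : ℕ} (hℓ : 1 ≤ ℓ) (hMh : 2 ≤ Mh) (a : Fin (d + 1) → ℤ) {M ρ k n : ℕ} (hn : 1 ≤ n) (hnk : n ≤ k)
    {P : Fin (d + 1) → ℕ} (hfit : ∀ μ, boxP ℓ M ρ k n μ ≤ P μ) {x : Fin (d + 1) → ℤ} (hx : x ∈ cube (ℓ + 1) a M ρ k 0) :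
    SiteDeep (N0 ℓ Mh n P) ((ρ * (ℓ + 1) ^ n : ℕ) : ℤ) (x + shift ℓ Mh a ρ k n) := by
  have hL2 : 2 ≤ ℓ + 1 := by omega
  have hk : 1 ≤ k := hn.trans hnk
  intro i
  rw [mem_cube_iff_inBox a M ρ (Nat.zero_le k)] at hx
  obtain ⟨h1, h2⟩ := hx i
  -- the two corner identities (G1)
  have e1 : loC (ℓ + 1) a ρ k 0 i + shift ℓ Mh a ρ k n i
      = ((Mh * (ℓ + 1) ^ (n + 1) * ρ : ℕ) : ℤ) + (fm (ℓ + 1) ρ k n : ℤ) - (fm (ℓ + 1) ρ k 0 : ℤ) := by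
    unfold shift loC; simp only [bLo]; push_cast; ring
  have e2 : hiC (ℓ + 1) a M ρ k 0 i + 1 + shift ℓ Mh a ρ k n i
      = (((ℓ + 1) ^ k * M : ℕ) : ℤ) + (fm (ℓ + 1) ρ k 0 : ℤ) + ((Mh * (ℓ + 1) ^ (n + 1) * ρ : ℕ) : ℤ) + (fm (ℓ + 1) ρ k n : ℤ) := by
    unfold shift hiC loC; simp only [bHi, bLo]; push_cast; ring
  -- natural-number bounds on the margins, with `ρLⁿ` to spare
  have hρn : ρ * (ℓ + 1) ^ n ≤ ρ * (ℓ + 1) ^ (k + 1) :=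
    Nat.mul_le_mul_left _ (Nat.pow_le_pow_right (Nat.succ_pos ℓ) (by omega))
  have hA : fm (ℓ + 1) ρ k 0 + ρ * (ℓ + 1) ^ n ≤ fm (ℓ + 1) ρ k n + Mh * (ℓ + 1) ^ (n + 1) * ρ := by
    have h := fm_zero_le (L := ℓ + 1) (ρ := ρ) (k := k) hL2 hn hnk
    have h' : 2 * (ρ * (ℓ + 1) ^ n) ≤ Mh * (ℓ + 1) ^ (n + 1) * ρ := by
      calc 2 * (ρ * (ℓ + 1) ^ n) = 2 * (ℓ + 1) ^ n * ρ := by ring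
        _ ≤ Mh * (ℓ + 1) ^ (n + 1) * ρ :=
          Nat.mul_le_mul (Nat.mul_le_mul hMh (Nat.pow_le_pow_right (Nat.succ_pos ℓ) (Nat.le_succ n))) le_rfl
    omega
  have hB : fm (ℓ + 1) ρ k 0 + fm (ℓ + 1) ρ k n + ρ * (ℓ + 1) ^ n ≤ 2 * (Mh * (ℓ + 1) ^ (k + 1) * ρ) := by
    have h0 : fm (ℓ + 1) ρ k 0 = fm (ℓ + 1) ρ k 1 + ρ * (ℓ + 1) ^ 0 := fm_succ (lt_of_lt_of_le Nat.zero_lt_one hk)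
    rw [pow_zero, mul_one] at h0
    have h1top : fm (ℓ + 1) ρ k 1 ≤ ρ * (ℓ + 1) ^ (k + 1) := fm_one_le_top hL2 hk
    have hn1 : fm (ℓ + 1) ρ k n ≤ fm (ℓ + 1) ρ k 1 := fm_le_fm_one hn hnk
    have hρle : ρ ≤ ρ * (ℓ + 1) ^ (k + 1) := by
      calc ρ = ρ * 1 := (mul_one ρ).symm
        _ ≤ ρ * (ℓ + 1) ^ (k + 1) := Nat.mul_le_mul_left _ (Nat.one_le_pow _ _ (Nat.succ_pos ℓ))
    have h4 : 4 * (ρ * (ℓ + 1) ^ (k + 1)) ≤ 2 * (Mh * (ℓ + 1) ^ (k + 1) * ρ) := by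
      calc 4 * (ρ * (ℓ + 1) ^ (k + 1)) = 2 * (2 * (ℓ + 1) ^ (k + 1) * ρ) := by ring
        _ ≤ 2 * (Mh * (ℓ + 1) ^ (k + 1) * ρ) := Nat.mul_le_mul_left _ (Nat.mul_le_mul_right _ (Nat.mul_le_mul_right _ hMh))
    omega
  have hD : (ℓ + 1) ^ k * M ≤ Mh * (ℓ + 1) ^ (k + 1) * M := by
    calc (ℓ + 1) ^ k * M = 1 * (ℓ + 1) ^ k * M := by ring
      _ ≤ Mh * (ℓ + 1) ^ (k + 1) * M :=
        Nat.mul_le_mul (Nat.mul_le_mul (by omega) (Nat.pow_le_pow_right (Nat.succ_pos ℓ) (Nat.le_succ k))) le_rfl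
  have hN := N0_boxP_eq (ℓ := ℓ) (Mh := Mh) (M := M) (ρ := ρ) hnk i
  have hNP : N0 ℓ Mh n (boxP ℓ M ρ k n) i ≤ N0 ℓ Mh n P i := N0_mono hfit i
  have hup : (ℓ + 1) ^ k * M + fm (ℓ + 1) ρ k 0 + Mh * (ℓ + 1) ^ (n + 1) * ρ + fm (ℓ + 1) ρ k n + ρ * (ℓ + 1) ^ n
      ≤ N0 ℓ Mh n P i := by
    rw [hN] at hNP; omega
  constructor
  · -- `ρLⁿ ≤ loC₀ + t ≤ x + t`
    have h3 : ((ρ * (ℓ + 1) ^ n : ℕ) : ℤ) ≤ loC (ℓ + 1) a ρ k 0 i + shift ℓ Mh a ρ k n i := by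
      rw [e1]
      have : ((fm (ℓ + 1) ρ k 0 + ρ * (ℓ + 1) ^ n : ℕ) : ℤ) ≤ ((fm (ℓ + 1) ρ k n + Mh * (ℓ + 1) ^ (n + 1) * ρ : ℕ) : ℤ) := by
        exact_mod_cast hA
      rw [Nat.cast_add, Nat.cast_add] at this
      linarith
    simp only [Pi.add_apply]
    linarith
  · -- `x + t + ρLⁿ ≤ hiC₀ + t + ρLⁿ ≤ N₀ − 1`
    have h3 : hiC (ℓ + 1) a M ρ k 0 i + 1 + shift ℓ Mh a ρ k n i + ((ρ * (ℓ + 1) ^ n : ℕ) : ℤ) ≤ (N0 ℓ Mh n P i : ℤ) := by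
      rw [e2]; exact_mod_cast hup
    simp only [Pi.add_apply]
    linarith

/-- The translated `□₀` lies in every host box with `P ≥ boxP` (`L ≥ 2`, `M_h ≥ 2`, `1 ≤ n ≤ k`). [cite: Balaban1984PropagatorsII, (2.1) p.224 («Ω_j ⊂ T_η»); Balaban1985RegularSpaces, p.98] -/
theorem mem_boxDom_shift_of_mem_cube_zero' {ℓ Mh : ℕ} (hℓ : 1 ≤ ℓ) (hMh : 2 ≤ Mh) (a : Fin (d + 1) → ℤ) {M ρ k n : ℕ} (hn : 1 ≤ n) (hnk : n ≤ k)
    (hρ0 : 0 < ρ) {P : Fin (d + 1) → ℕ} (hfit : ∀ μ, boxP ℓ M ρ k n μ ≤ P μ) {x : Fin (d + 1) → ℤ} (hx : x ∈ cube (ℓ + 1) a M ρ k 0) :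
    x + shift ℓ Mh a ρ k n ∈ boxDom (N0 ℓ Mh n P) := by
  have h := siteDeep_shift_of_mem_cube_zero hℓ hMh a hn hnk hfit hx
  rw [mem_boxDom]
  intro i
  obtain ⟨h1, h2⟩ := h i
  have h0 : (0 : ℤ) < ((ρ * (ℓ + 1) ^ n : ℕ) : ℤ) := by positivity
  constructor <;> linarith

/-! ## §3 The cube member as a level-`0` TORUS family -/

/-- ★★ **THE CUBE MEMBER `(T, t+□₁, …, t+□_n)` IS A MEMBER OF THE [B6] §2 TORUS FAMILY WITH `Λ₀`** (`B6MultiLevelTorusOperatorL0.TDomains d ℓ M_h n P R`): levels `0 … n` —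
`Ω_j = t + □_j` for `1 ≤ j ≤ n`, `Λ₀ = T ∖ (t + □₁)` (the shell `t + (□₀ ∖ □₁)` together with the rest of the torus) — with (2.1) «Ω_j is a sum of big blocks» for every `j ≥ 1`
and (2.2) `dist_T(Ω_jᶜ, Ω_{j+1}) > R·M_hL^{j+1}` IN THE TORUS METRIC: the flat gap is `> ρLʲ ≥ R·M_hL^{j+1}` in some coordinate (F1 `collar_gap`), and a wrap-around is never shorter
because every site of `t + □_{j+1} ⊂ t + □₀` is `ρLⁿ`-deep in the fundamental box (§2).  Host: any `P ≥ boxP` componentwise (e.g. §1's `torP`).  Print ([B6] p. 224): «we admit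
the case when some domains Ω_j are equal to T_η»; ([B8] (1.131)) «Λ′₀ = T ∖ □₁».
[cite: Balaban1984PropagatorsII, (2.1)–(2.4) p.224, (2.14) p.225, p.229; Balaban1985RegularSpaces, p.98, (1.131) p.99] -/
def cubeTDomainsL0 {ℓ Mh : ℕ} (hℓ : 1 ≤ ℓ) (hMh : 2 ≤ Mh) (a : Fin (d + 1) → ℤ) {M ρ k n R : ℕ} (hn : 1 ≤ n) (hnk : n ≤ k)
    (hρ : Mh * (ℓ + 1) ∣ ρ) (hM : Mh * (ℓ + 1) ∣ M) (hρ0 : 0 < ρ) (hR : R * (Mh * (ℓ + 1)) ≤ ρ)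
    (P : Fin (d + 1) → ℕ) (hfit : ∀ μ, boxP ℓ M ρ k n μ ≤ P μ) :
    B6MultiLevelTorusOperatorL0.TDomains d ℓ Mh n P R where
  lev := levL0 ℓ Mh a M ρ k n
  lev_le := levL0_le ℓ Mh a M ρ k hn
  bigBlocks := by
    have hMh1 : 1 ≤ Mh := le_trans (by norm_num) hMh
    have hρL : ℓ + 1 ≤ ρ := le_trans (Nat.le_mul_of_pos_left _ hMh1) (Nat.le_of_dvd hρ0 hρ)
    intro j hj y _ y' _ hyy
    by_cases hjn : j ≤ n
    · rw [le_levL0_iff a M hρL hnk hj hjn y, le_levL0_iff a M hρL hnk hj hjn y']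
      exact mem_cube_iff_of_blk_eq hMh1 a hρ hM hjn hnk hyy
    · have h1 := levL0_le ℓ Mh a M ρ k hn y
      have h2 := levL0_le ℓ Mh a M ρ k hn y'
      constructor <;> intro h <;> omega
  sepT := by
    have hMh1 : 1 ≤ Mh := le_trans (by norm_num) hMh
    have hρL : ℓ + 1 ≤ ρ := le_trans (Nat.le_mul_of_pos_left _ hMh1) (Nat.le_of_dvd hρ0 hρ)
    have hN1 : ∀ i, 1 ≤ N0 ℓ Mh n P i := by
      intro i
      have hP1 : 1 ≤ P i := le_trans (le_trans hρ0 (by unfold boxP; omega)) (hfit i)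
      simp only [N0]
      exact Nat.one_le_iff_ne_zero.mpr (by positivity)
    intro j y hy y' hy' hlt hle
    have h2 := levL0_le ℓ Mh a M ρ k hn y'
    have hjn : j + 1 ≤ n := le_trans hle h2
    have hj1 : 1 ≤ j := by
      rcases Nat.eq_zero_or_pos j with h0 | hpos
      · subst h0; exact absurd hlt (Nat.not_lt_zero _)
      · exact hpos
    have hy'c : y' - shift ℓ Mh a ρ k n ∈ cube (ℓ + 1) a M ρ k (j + 1) :=
      (le_levL0_iff a M hρL hnk (Nat.succ_pos j) hjn y').mp hle
    have hyc : y - shift ℓ Mh a ρ k n ∉ cube (ℓ + 1) a M ρ k j :=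
      fun h => absurd ((le_levL0_iff a M hρL hnk hj1 (by omega) y).mpr h) (not_le.mpr hlt)
    -- the flat gap in some coordinate
    obtain ⟨i, hi⟩ := collar_gap a (lt_of_lt_of_le (Nat.lt_of_succ_le hjn) hnk) hyc hy'c
    have hsub : (y - shift ℓ Mh a ρ k n) i - (y' - shift ℓ Mh a ρ k n) i = y i - y' i := by
      simp only [Pi.sub_apply]; ring
    rw [hsub] at hi
    -- `y'` is `ρLⁿ`-deep: no short wrap-around
    have hy'0 : y' - shift ℓ Mh a ρ k n ∈ cube (ℓ + 1) a M ρ k 0 :=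
      cube_anti (Nat.zero_le _) (hjn.trans hnk) hy'c
    have hdeep := siteDeep_shift_of_mem_cube_zero hℓ hMh a hn hnk hfit hy'0
    rw [sub_add_cancel] at hdeep
    obtain ⟨hyi0, hyiN⟩ := (mem_boxDom.1 hy) i
    have hw : (0 : ℤ) < ((ρ * (ℓ + 1) ^ n : ℕ) : ℤ) := by positivity
    have hmin := min_le_circAbs_sub (N := N0 ℓ Mh n P i) hyi0 hyiN hw (hdeep i).1 (hdeep i).2
    -- both entries of the `min` exceed `ρLʲ`
    have hLj : ((ρ : ℤ) * (((ℓ + 1 : ℕ) : ℤ)) ^ j) < ((ρ * (ℓ + 1) ^ n : ℕ) : ℤ) := by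
      have hjlt : (ℓ + 1) ^ j < (ℓ + 1) ^ n := Nat.pow_lt_pow_right (by omega) (by omega)
      have : ρ * (ℓ + 1) ^ j < ρ * (ℓ + 1) ^ n := Nat.mul_lt_mul_of_pos_left hjlt hρ0
      exact_mod_cast this
    have hi' : (ρ : ℤ) * (((ℓ + 1 : ℕ) : ℤ)) ^ j < |y' i - y i| := by rw [abs_sub_comm]; exact_mod_cast hi
    have hgap : (ρ : ℤ) * (((ℓ + 1 : ℕ) : ℤ)) ^ j < circAbs (N0 ℓ Mh n P i) (y' i - y i) :=
      lt_of_lt_of_le (lt_min hi' hLj) hmin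
    -- `R·M_hL^{j+1} ≤ ρLʲ < |·|_T`
    have hRle : ((R * bigSide ℓ Mh j : ℕ) : ℝ) ≤ ((ρ * (ℓ + 1) ^ j : ℕ) : ℝ) := by exact_mod_cast R_bigSide_le hR j
    have hgapR : ((ρ * (ℓ + 1) ^ j : ℕ) : ℝ) < ((circAbs (N0 ℓ Mh n P i) ((y' - y) i) : ℤ) : ℝ) := by
      have : ((ρ * (ℓ + 1) ^ j : ℕ) : ℤ) < circAbs (N0 ℓ Mh n P i) ((y' - y) i) := by
        rw [Pi.sub_apply]; push_cast; exact hgap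
      exact_mod_cast this
    have hle : ((circAbs (N0 ℓ Mh n P i) ((y' - y) i) : ℤ) : ℝ) ≤ torusSupNorm (N0 ℓ Mh n P) (y' - y) :=
      Finset.le_sup' (fun μ => ((circAbs (N0 ℓ Mh n P μ) ((y' - y) μ) : ℤ) : ℝ)) (Finset.mem_univ i)
    rw [show y - y' = -(y' - y) by abel, torusSupNorm_neg hN1]
    exact lt_of_le_of_lt hRle (lt_of_lt_of_le hgapR hle)

/-- The level function of the torus member is `levL0`. [cite: Balaban1984PropagatorsII, (2.3)–(2.4) p.224] -/
theorem cubeTDomainsL0_lev {ℓ Mh : ℕ} (hℓ : 1 ≤ ℓ) (hMh : 2 ≤ Mh) (a : Fin (d + 1) → ℤ) {M ρ k n R : ℕ} (hn : 1 ≤ n) (hnk : n ≤ k)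
    (hρ : Mh * (ℓ + 1) ∣ ρ) (hM : Mh * (ℓ + 1) ∣ M) (hρ0 : 0 < ρ) (hR : R * (Mh * (ℓ + 1)) ≤ ρ)
    (P : Fin (d + 1) → ℕ) (hfit : ∀ μ, boxP ℓ M ρ k n μ ≤ P μ) :
    (cubeTDomainsL0 hℓ hMh a hn hnk hρ hM hρ0 hR P hfit).lev = levL0 ℓ Mh a M ρ k n := rfl

/-- The box family of the torus member has the same level function (`TDomains.toDomains`). [cite: Balaban1984PropagatorsII, (2.1)–(2.4) p.224, dictionary] -/
theorem cubeTDomainsL0_toDomains_lev {ℓ Mh : ℕ} (hℓ : 1 ≤ ℓ) (hMh : 2 ≤ Mh) (a : Fin (d + 1) → ℤ) {M ρ k n R : ℕ} (hn : 1 ≤ n) (hnk : n ≤ k)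
    (hρ : Mh * (ℓ + 1) ∣ ρ) (hM : Mh * (ℓ + 1) ∣ M) (hρ0 : 0 < ρ) (hR : R * (Mh * (ℓ + 1)) ≤ ρ)
    (P : Fin (d + 1) → ℕ) (hfit : ∀ μ, boxP ℓ M ρ k n μ ≤ P μ) :
    (B6MultiLevelTorusOperatorL0.TDomains.toDomains (cubeTDomainsL0 hℓ hMh a hn hnk hρ hM hρ0 hR P hfit)).lev = levL0 ℓ Mh a M ρ k n := rfl

/-- ★ **`Ω_j = {j ≤ lev}` OF THE TORUS MEMBER IS THE TRANSLATED `□_j`** (`1 ≤ j ≤ n`): `j ≤ lev y ⇔ y − t ∈ □_j`.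
[cite: Balaban1984PropagatorsII, (2.3)–(2.4) p.224; Balaban1985RegularSpaces, (1.131) p.99] -/
theorem le_lev_cubeTDomainsL0_iff {ℓ Mh : ℕ} (hℓ : 1 ≤ ℓ) (hMh : 2 ≤ Mh) (a : Fin (d + 1) → ℤ) {M ρ k n R : ℕ} (hn : 1 ≤ n) (hnk : n ≤ k)
    (hρ : Mh * (ℓ + 1) ∣ ρ) (hM : Mh * (ℓ + 1) ∣ M) (hρ0 : 0 < ρ) (hR : R * (Mh * (ℓ + 1)) ≤ ρ)
    (P : Fin (d + 1) → ℕ) (hfit : ∀ μ, boxP ℓ M ρ k n μ ≤ P μ) {j : ℕ} (hj : 1 ≤ j) (hjn : j ≤ n) (y : Fin (d + 1) → ℤ) :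
    j ≤ (cubeTDomainsL0 hℓ hMh a hn hnk hρ hM hρ0 hR P hfit).lev y ↔ y - shift ℓ Mh a ρ k n ∈ cube (ℓ + 1) a M ρ k j := by
  have hρL : ℓ + 1 ≤ ρ := le_trans (Nat.le_mul_of_pos_left _ (le_trans (by norm_num) hMh)) (Nat.le_of_dvd hρ0 hρ)
  exact le_levL0_iff a M hρL hnk hj hjn y

/-- **LEVEL `0` OF THE TORUS MEMBER IS `T ∖ (t + □₁)`**: `0 < lev y ⇔ y − t ∈ □₁`. [cite: Balaban1984PropagatorsII, (2.3)–(2.4) p.224 («Λ₀ = Ω₁ᶜ»); Balaban1985RegularSpaces, (1.131) p.99 («Λ′₀ = T ∖ □₁»)] -/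
theorem lev_cubeTDomainsL0_pos_iff {ℓ Mh : ℕ} (hℓ : 1 ≤ ℓ) (hMh : 2 ≤ Mh) (a : Fin (d + 1) → ℤ) {M ρ k n R : ℕ} (hn : 1 ≤ n) (hnk : n ≤ k)
    (hρ : Mh * (ℓ + 1) ∣ ρ) (hM : Mh * (ℓ + 1) ∣ M) (hρ0 : 0 < ρ) (hR : R * (Mh * (ℓ + 1)) ≤ ρ)
    (P : Fin (d + 1) → ℕ) (hfit : ∀ μ, boxP ℓ M ρ k n μ ≤ P μ) (y : Fin (d + 1) → ℤ) :
    0 < (cubeTDomainsL0 hℓ hMh a hn hnk hρ hM hρ0 hR P hfit).lev y ↔ y - shift ℓ Mh a ρ k n ∈ cube (ℓ + 1) a M ρ k 1 := by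
  have hρL : ℓ + 1 ≤ ρ := le_trans (Nat.le_mul_of_pos_left _ (le_trans (by norm_num) hMh)) (Nat.le_of_dvd hρ0 hρ)
  exact levL0_pos_iff a M hρL hn hnk y

/-! ## §4 The identity chart of the V1 torus at the member -/

section Chart

variable {ℓ : ℕ} {mV KV : ℕ} {hd : 1 ≤ d + 1} {hL : Odd (ℓ + 1) ∧ 1 < ℓ + 1}

/-- **THE TORUS LEVEL OF A V1 SITE IS `levL0` OF ITS LABEL VECTOR** (the identity chart `B6GlobalChartV1.toBox`): for the member `D = cubeTDomainsL0 …` and every site `x` of the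
V1 torus, `D.lev (toBox hN x) = levL0 … (toBox hN x)` — definitional, recorded for the consumers of `blkV1`∕`domT`. [cite: Balaban1984PropagatorsII, (2.1)–(2.4) p.224, dictionary] -/
theorem lev_cubeTDomainsL0_toBox {Mh : ℕ} (hℓ : 1 ≤ ℓ) (hMh : 2 ≤ Mh) (a : Fin (d + 1) → ℤ) {M ρ k n R : ℕ} (hn : 1 ≤ n) (hnk : n ≤ k)
    (hρ : Mh * (ℓ + 1) ∣ ρ) (hM : Mh * (ℓ + 1) ∣ M) (hρ0 : 0 < ρ) (hR : R * (Mh * (ℓ + 1)) ≤ ρ)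
    {P : Fin (d + 1) → ℕ} (hfit : ∀ μ, boxP ℓ M ρ k n μ ≤ P μ) (hN : ∀ μ, N0 ℓ Mh n P μ = (PV d ℓ mV KV hd hL).sitesPerDir 0)
    (x : Site (PV d ℓ mV KV hd hL) 0) :
    (cubeTDomainsL0 hℓ hMh a hn hnk hρ hM hρ0 hR P hfit).lev (toBox hN x : Fin (d + 1) → ℤ) =
      levL0 ℓ Mh a M ρ k n (fun μ => ((x μ).val : ℤ)) := rfl

/-- **A V1 SITE LIES IN THE TRANSLATED `□_j` IFF ITS LABEL VECTOR DOES** (`1 ≤ j ≤ n`), read through the member's level function.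
[cite: Balaban1984PropagatorsII, (2.1)–(2.4) p.224; Balaban1985RegularSpaces, (1.131) p.99] -/
theorem le_lev_toBox_iff {Mh : ℕ} (hℓ : 1 ≤ ℓ) (hMh : 2 ≤ Mh) (a : Fin (d + 1) → ℤ) {M ρ k n R : ℕ} (hn : 1 ≤ n) (hnk : n ≤ k)
    (hρ : Mh * (ℓ + 1) ∣ ρ) (hM : Mh * (ℓ + 1) ∣ M) (hρ0 : 0 < ρ) (hR : R * (Mh * (ℓ + 1)) ≤ ρ)
    {P : Fin (d + 1) → ℕ} (hfit : ∀ μ, boxP ℓ M ρ k n μ ≤ P μ) (hN : ∀ μ, N0 ℓ Mh n P μ = (PV d ℓ mV KV hd hL).sitesPerDir 0)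
    {j : ℕ} (hj : 1 ≤ j) (hjn : j ≤ n) (x : Site (PV d ℓ mV KV hd hL) 0) :
    j ≤ (cubeTDomainsL0 hℓ hMh a hn hnk hρ hM hρ0 hR P hfit).lev (toBox hN x : Fin (d + 1) → ℤ) ↔
      (fun μ => ((x μ).val : ℤ)) - shift ℓ Mh a ρ k n ∈ cube (ℓ + 1) a M ρ k j :=
  le_lev_cubeTDomainsL0_iff hℓ hMh a hn hnk hρ hM hρ0 hR P hfit hj hjn _

end Chart

end Literature.MathematicalPhysics.QuantumFieldTheory.Balaban1983to89.B8CubeMemberTorusDomainsL0
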